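import Summits.KontsevichZagierPeriods.KontsevichZagierPeriods.Theses.FurushoPentagon
import Literature.NumberTheory.Transcendental.KZRulesAssociator
import Mathlib.Algebra.DualNumber

/-!
# Line `Sketch` for crux `ReducedPeriodRing` (stmt-KontsevichZagierPeriods-3929) — lead a1's checks

Kernel-checked facts about the two registered stubs of `Lines/Sketch.lean`
(A1 `stub_nilIsPiTorsion : NilIsPiTorsion`, A2 `stub_piCancellation : KZ.PiCancellation`):

1. `reducedPeriodRing_iff_nil_and_cancelOnNil` — **the Sketch line is a FACTORISATION of the crux,
   not a reduction of it**: `ReducedPeriodRing ↔ NilIsPiTorsion ∧ PiCancellationOnNil`, where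
   `PiCancellationOnNil` (`[π]`-cancellation on square-zero classes only) is the part of A2 the
   composition actually consumes. Both factors are corollaries of the crux (`N = 0`, resp. trivially),
   so the line makes progress only if a factor has a source independent of the crux.
2. `piCancellationOnNil_of_piCancellation` — A2 as registered (item 0540, open conjecture) is the
   only source on file for the second factor.
3. Drop-one models over the abstract interface (a commutative ring `R` with an element `t` playing
   `⟦[π]⟧`): `nil_torsion_without_cancellation_not_reduced` (`R = ℚ[ε]/(ε²)`, `t = ε`: every
   square-zero element is `t`-torsion, `R` not reduced) and `cancellation_without_torsion_not_reduced`
   (`R = ℚ[ε]/(ε²)`, `t = 1`: `t` is regular, `R` not reduced). So neither factor alone carries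
   reducedness abstractly; cf. `Cruxes/ReducedPeriodRing/Disproof.lean` §9 and
   `Theorems/ReducedPeriodRing/Negative/LineLoadBearing.lean` for the same verdict on the sibling
   Cartier-pullback line.
-/

noncomputable section

namespace Summit.KontsevichZagierPeriods.FurushoPentagon.ReducedPeriodRing.SketchLineChecks

open Literature.NumberTheory.Transcendental Literature.NumberTheory.Transcendental.KZ
open Summit.KontsevichZagierPeriods.KontsevichZagierPeriods.Theses.FurushoPentagon

/-- A1 of the Sketch line: square-zero classes are `[π]`-power torsion modulo relations. [Sketch Card A] -/
def NilIsPiTorsion : Prop :=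
  ∀ c : FormalRep, c * c ∈ relations → ∃ N : ℕ, (fun d => of piRep * d)^[N] c ∈ relations

/-- The part of A2 (`KZ.PiCancellation`) that the Card-A composition consumes: `[π]`-cancellation on
square-zero classes. [folklore] -/
def PiCancellationOnNil : Prop :=
  ∀ c : FormalRep, c * c ∈ relations → of piRep * c ∈ relations → c ∈ relations

/-- The crux gives A1 with exponent `N = 0`. [folklore] -/
theorem nilIsPiTorsion_of_reduced (h : ReducedPeriodRing) : NilIsPiTorsion :=
  fun c hc => ⟨0, by simpa using h c hc⟩

/-- The crux gives `PiCancellationOnNil` (the `[π]`-hypothesis is not even used). [folklore] -/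
theorem piCancellationOnNil_of_reduced (h : ReducedPeriodRing) : PiCancellationOnNil :=
  fun c hc _ => h c hc

/-- A2 as registered (item stmt-KontsevichZagierPeriods-0540) gives `PiCancellationOnNil`. [folklore] -/
theorem piCancellationOnNil_of_piCancellation (h : PiCancellation) : PiCancellationOnNil :=
  fun c _ hπ => h c hπ

/-- Square-zero classes are stable under `[π] * ·`: computed in the commutative ring
`P = FormalRep ⧸ relations` through `KZ.toFormalPeriod`, `⟦(πc)(πc)⟧ = ⟦π⟧² ⟦c⟧² = 0`. [folklore] -/
theorem sq_mem_relations_piMul {c : FormalRep} (hc : c * c ∈ relations) :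
    (of piRep * c) * (of piRep * c) ∈ relations := by
  rw [← toFormalPeriod_eq_zero_iff] at hc ⊢
  rw [map_mul] at hc
  rw [map_mul, map_mul]
  have : toFormalPeriod (of piRep) * toFormalPeriod c * (toFormalPeriod (of piRep) * toFormalPeriod c)
      = toFormalPeriod (of piRep) * toFormalPeriod (of piRep) * (toFormalPeriod c * toFormalPeriod c) := by
    ring
  rw [this, hc, mul_zero]

/-- Every iterate `[π]^{*N} * c` of a square-zero class is square-zero. [folklore] -/
theorem iterate_sq_mem_relations {c : FormalRep} (hc : c * c ∈ relations) (N : ℕ) :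
    (fun d => of piRep * d)^[N] c * (fun d => of piRep * d)^[N] c ∈ relations := by
  induction N with
  | zero => simpa using hc
  | succ n ih =>
    rw [Function.iterate_succ_apply']
    exact sq_mem_relations_piMul ih

/-- The Card-A composition run with only the consumed part of A2. [Sketch Card A] -/
theorem reduced_of_nilIsPiTorsion_of_cancelOnNil (h1 : NilIsPiTorsion) (h2 : PiCancellationOnNil) :
    ReducedPeriodRing := by
  intro c hc
  obtain ⟨N, hN⟩ := h1 c hc
  induction N with
  | zero => simpa using hN
  | succ n ih =>
    apply ih
    rw [Function.iterate_succ_apply'] at hN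
    exact h2 _ (iterate_sq_mem_relations hc n) hN

/-- **The Sketch line factors the crux into two of its own corollaries.** [folklore] -/
theorem reducedPeriodRing_iff_nil_and_cancelOnNil :
    ReducedPeriodRing ↔ NilIsPiTorsion ∧ PiCancellationOnNil :=
  ⟨fun h => ⟨nilIsPiTorsion_of_reduced h, piCancellationOnNil_of_reduced h⟩,
    fun h => reduced_of_nilIsPiTorsion_of_cancelOnNil h.1 h.2⟩

/-! ## Drop-one models over the abstract interface `(R, t)` -/

/-- `ℚ[ε]/(ε²)` is not reduced. [folklore] -/
theorem not_isReduced_dualNumber : ¬ IsReduced (DualNumber ℚ) := by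
  intro h
  have h0 : (DualNumber.eps : DualNumber ℚ) = 0 :=
    IsReduced.eq_zero _ ⟨2, by rw [pow_two, DualNumber.eps_mul_eps]⟩
  have := congrArg TrivSqZeroExt.snd h0
  simp at this

/-- A1 without A2 carries no reducedness: in `R = ℚ[ε]/(ε²)` with `t = ε` every square-zero element
is killed by `t ^ 2` (indeed `t ^ 2 = 0`), yet `R` is not reduced. [folklore] -/
theorem nil_torsion_without_cancellation_not_reduced :
    ∃ (R : Type) (_ : CommRing R) (t : R),
      (∀ y : R, y * y = 0 → ∃ N : ℕ, t ^ N * y = 0) ∧ ¬ IsReduced R :=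
  ⟨DualNumber ℚ, inferInstance, DualNumber.eps,
    fun y _ => ⟨2, by rw [pow_two, DualNumber.eps_mul_eps, zero_mul]⟩,
    not_isReduced_dualNumber⟩

/-- A2 without A1 carries no reducedness: in `R = ℚ[ε]/(ε²)` with `t = 1` the element `t` is regular
(cancellation holds everywhere), yet `R` is not reduced. [folklore] -/
theorem cancellation_without_torsion_not_reduced :
    ∃ (R : Type) (_ : CommRing R) (t : R), (∀ y : R, t * y = 0 → y = 0) ∧ ¬ IsReduced R :=
  ⟨DualNumber ℚ, inferInstance, 1, fun y hy => by simpa using hy, not_isReduced_dualNumber⟩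

end Summit.KontsevichZagierPeriods.FurushoPentagon.ReducedPeriodRing.SketchLineChecks
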